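import Summits.ABC.IUTFork.Cor312LicenceShallowRealTame
import Summits.ABC.IUTFork.Thm311RealIsmDHNonIsometryMover
import HarnessLib

/-!
# [IUTchIII] Cor. 3.12 — the (xi-f) LICENCE at the sharp real settings from (Ind2)-movers on ALL `j+1` CAPSULE SLOTS
# (the non-last slots DONATE content: the inhabited tame window is wider than the one-factor window by `j·(e−1)`)

PROOF-ONLY record file (D-0012; 0 definitions, 0 `Prop` facts) of the abc-iut cell (WAVE-5 prover seat abc-iut-w5-d180,
gen 5; row «LICENCE-MULTISLOT-LOWER», HOME/STATUS 2026-08-26T10:4xZ). TAKES NO SIDE on [IUTchIII] Cor. 3.12 (S. Mochizuki,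
*Inter-universal Teichmüller theory III*, kurims manuscript `paper:url-4b091feeb646`, Cor. 3.12 p. 173 l. 41 – p. 174 l. 19;
proof p. 174 l. 50 – p. 175 l. 1 «the holomorphic hull of the union of the possible images»; Step (xi) (xi-f) p. 184 l. 26–27;
Thm. 3.11 (i) (Ind2) p. 154 «the action of independent copies of Ism … on each of the direct summands of the `j+1` factors»)
or on any author: every statement is about OUR typed objects — abc-iut-c312-1's `Thm311ToCor312.Licence`, abc-iut-c312-3's /
abc-iut-c312-7's SHARP idele settings `Real.settingDHVolSharp` / `Real.settingPrVolSharp` (Θ-boxes `ι_j(t_{Θ,j,v_j})·(R_I)^∼`,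
q-boxes `ι_j(t_{q,v_j})·(R_I)^∼`, Dupuy–Hilado §3.9), and the typed (Ind2) of abc-iut-c312-5's `Real.logShellsDH`
(`Real.ismDH`: ALL bicontinuous lattice automorphisms of the log-shell `I_v`, Dupuy–Hilado §4.9), which abc-iut-c312-1's
`LogShells.Ind2 j v_ℚ` indexes by (CAPSULE SLOT, place) — `g : Caps j → ∀ v, …`.

CONTEXT. The one-factor legs are LANDED: abc-iut-w4-d094 `Cor312LicenceOfReach` (p437055/p437564) and abc-iut-w5-d236
`Cor312LicenceShallowReal` (p437725) prove «a mover `g_v ∈ Ism_v` on the LAST slot with `‖t_{q,v}‖ ≤ ‖g_v(t_{Θ,j,v})‖` at every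
place ⇒ Licence», and abc-iut-w5-d236 `Cor312LicenceShallowRealTame` (p438095) discharges that mover in the tame window
`‖p‖·‖p‖^k‖ϖ‖ < ‖t_Θ‖ ≤ ‖p‖^k‖ϖ‖ ∧ ‖t_q‖ ≤ ‖p‖^k‖ϖ‖` (one factor: `m_q ≥ e·⌈m_Θ/e⌉ − (e−1)` in orders). THIS FILE lets ALL `j+1`
slots move, which is what the typed (Ind2) allows:

* §1 **`qRegion_subset_thetaHull_settingDHVolSharp_of_slotMovers`** — at `(j, p)`: given movers `g_{a,x} ∈ Ism_x` for EVERY slot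
  `a ∈ S^±_{j+1}` and place `x | p`, the box point `x₀ = 1 ⊗ ⋯ ⊗ 1 ⊗ t_{Θ,j,v_j}` (in the sharp Θ-box at EVERY summand `v⃗`) is
  carried by the (Ind2)-element `⊗_a ⊕_x g_{a,x}` to the pure tensor `g_{0,v_0}(1) ⊗ ⋯ ⊗ g_{j−1,v_{j−1}}(1) ⊗ g_{j,v_j}(t_{Θ,j,v_j})`,
  ALL of whose field-factor coordinates have norm `Π_{a<j} ‖g_{a,v_a}(1)‖ · ‖g_{j,v_j}(t_{Θ,j,v_j})‖` (abc-iut-w5-d216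
  `NonIsometryMover.norm_dEquiv_purePacket`); so (frame lemma of p437725) `q-region ⊆ ⁿ˒°𝒰_{j,p}` as soon as at EVERY tuple `v⃗`
  that product is `≥ ‖t_{q,v_j}‖`;
* §2 `…_of_twoFamilies` — the same with one family `g₁` on the non-last slots (evaluated at `1`) and one `g₂` on the last slot
  (evaluated at `t_Θ`): `‖t_{q,v_j}‖ ≤ (Π_{a<j} ‖g₁_{v_a}(1)‖)·‖g₂_{v_j}(t_{Θ,j,v_j})‖` for every tuple;
* §3 **`licence_settingDHVolSharp_of_slotMovers`** / **`licence_settingPrVolSharp_of_slotMovers`** /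
  **`exists_qPinned_and_hull_settingPrVolSharp_of_slotMovers`** (branch C's «∃ ρ qK, QPinned ∧ PilotKummerCompatHull», all labels).

WHY IT MATTERS (numbers; the tame evaluation is the companion append once p438095 is built). At a tame place `v` (`p > 2`,
`e_v ≤ p − 2`, analytic logarithm) `1` lies on the `p`-level `k = −1` of `𝔪_v` (`‖p‖·‖p‖⁻¹‖ϖ_v‖ = ‖ϖ_v‖ < 1 ≤ ‖p‖⁻¹‖ϖ_v‖ = ‖ϖ_v‖^{1−e_v}`),
so a lattice isomorphism of `I_v = p⁻¹𝔪_v` moves `1` to norm `‖ϖ_v‖^{1−e_v} > 1`: every NON-LAST slot DONATES `e_v − 1` orders. At a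
prime with a single tame place `w` (`‖t_Θ‖ = ‖ϖ‖^{m_Θ}`, `‖t_q‖ = ‖ϖ‖^{m_q}`) the licence at `(j, p)` is therefore INHABITED as soon as
`m_q ≥ e·⌈m_Θ/e⌉ − (j+1)(e−1)` — to be compared with abc-iut-w4-d026's UPPER leg «refuted when `m_q < e·⌊m_Θ/e⌋ − (j+1)(e−1)`»
(row «EXPLICIT-DEPTH-SHARP-TAME»): an EXACT per-datum dichotomy when `e ∣ m_Θ`, a gap of `< e` orders otherwise. Example beyond
the one-factor window: `F = ℚ(√7)` (tree: `RamifiedMover.F7`, `v7`, `e = 2`, `p = 7`), `l = 5`, realising ideles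
`ord(t_q) = 1`, `ord(t_{Θ,2}) = 4`: `1 ≥ 2·2 − 3·1` — inhabited at the boundary (abc-iut-w6-d114's pencil analysis 09:38:19Z).

HONEST SCOPE. Statements about OUR typed sharp containers (Θ-regions constant in `m`) and Dupuy–Hilado's typed (Ind1)/(Ind2)
(`logShellsDH`); the licence / hull readings are STRONGER-THAN-PRINT forms (ADJUDICATION-SPEC §2 (G1′)); nothing here bears on the
printed GLOBAL inequality, the author's intended hull, or the M-level `Ism`; nothing asserts or refutes [IUTchIII] Cor. 3.12.
[cite: Mochizuki2012, IUTchIII Cor. 3.12 p.173–175, Thm. 3.11 (i) p.154, Step (xi) p.184] [cite: DupuyHilado2025, §3.9, §4.7, §4.9]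
[claim: Mochizuki2012, status: disputed] for every IUT sentence quoted. Consumed BY NAME, nothing restated. typed ≠ proved;
instantiated ≠ endorsed.
-/

noncomputable section

open Set Function
open scoped Pointwise

namespace Summit.ABC.IUTFork.Thm311.Real

open Cor312 Cor312.Setting Cor312Vol Literature.IUT.LogThetaLattice Literature.IUT.LogVolume NumberField IsDedekindDomain
open Literature.NumberTheory.NumberFields Literature.NumberTheory.GaloisRepresentations.Ultrametric

variable {F : Type} [Field F] [NumberField F] (X : PilotData F) {logv : PadicLogs F} (hlog : LogvAnalytic logv)
  (M : Type) [Field M] [NumberField M]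
  (archPk : ∀ (j : (thetaIndex X).Label) (vQ : (thetaIndex X).VQ), Set ((logShellsDH X logv).Packet j vQ))
  (archSub : ∀ (j : (thetaIndex X).Label) (v : (thetaIndex X).V),
    Set ((logShellsDH X logv).Packet j ((thetaIndex X).over v)))
  (Ψ : ℤ → ∀ v : (thetaIndex X).V, v ∈ (thetaIndex X).Vbad → Set ((logShellsDH X logv).StarPacket v))
  (act : ℤ → ∀ v : (thetaIndex X).V, v ∈ (thetaIndex X).Vbad →
    (logShellsDH X logv).StarPacket v → Module.End ℚ ((logShellsDH X logv).StarPacket v))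
  (Mmod : ℤ → ∀ j : (thetaIndex X).LabelStar, Set ((logShellsDH X logv).GlobalPacket j.1))
  (region : ℤ → ∀ j : (thetaIndex X).LabelStar, FinDivisor M → ∀ vQ : (thetaIndex X).VQ,
    Set ((logShellsDH X logv).Packet j.1 vQ))
  (n : ℤ) {HT : Type} {LogLink : HT → HT → Type} {IsFull : ∀ {s t : HT}, LogLink s t → Prop}
  (lat : LGPGaussianLogThetaLattice LogLink IsFull)
  {Frd : Type} {IsoF : Frd → Frd → Type} {Ob : Frd → Type} {realify : Frd → Frd} {Strip : Type}
  {IsoS : Strip → Strip → Type} {Mv : ∀ v : (thetaIndex X).V, v ∈ (thetaIndex X).Vbad → Type}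
  [∀ v h, Monoid (Mv v h)]
  (sig : GlobalLGPFrobenioidSignature (thetaIndex X).lstar (thetaIndex X).V (· ∈ (thetaIndex X).Vbad)
    Frd IsoF Ob realify Strip IsoS Mv)
  (split : SplittingMonoids Mv) {ObΔ : Type} {N : ∀ v : (thetaIndex X).V, v ∈ (thetaIndex X).Vbad → Type}
  [∀ v h, Monoid (N v h)] (qData : QPilotData ObΔ N)
  (tq : ∀ (pp : Nat.Primes) (x : (thetaIndex X).Fibre (.inr pp)), haveI : Fact (pp : ℕ).Prime := ⟨pp.2⟩; kOf X pp.1 x)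
  (t : ∀ (pp : Nat.Primes) (_ : Fin X.lstar) (x : (thetaIndex X).Fibre (.inr pp)),
    haveI : Fact (pp : ℕ).Prime := ⟨pp.2⟩; kOf X pp.1 x)
  (htq0 : ∀ pp x, tq pp x ≠ 0)
  (htq1 : ∀ (pp : Nat.Primes) (x : (thetaIndex X).Fibre (.inr pp)),
    haveI : Fact (pp : ℕ).Prime := ⟨pp.2⟩; placeOf X pp.1 x ∉ X.S → ‖tq pp x‖ = 1)
  (col : ℤ → Column (logShellsDH X logv))

/-! ## 1. q-region below the Θ-hull from movers on every capsule slot -/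

/-- At an archimedean `v_ℚ` the q-region lies in the Θ-hull unconditionally (no field factor there: the modelling choice of
abc-iut-c312-5's trivial archimedean container). [folklore] -/
theorem qRegion_subset_thetaHull_settingDHVolSharp_inl (j : (thetaIndex X).Label) (u : Unit) :
    (settingDHVolSharp X hlog M archPk archSub Ψ act Mmod region n lat sig split qData tq t htq0 htq1).qRegion j (.inl u) ⊆
      (settingDHVolSharp X hlog M archPk archSub Ψ act Mmod region n lat sig split qData tq t htq0 htq1).thetaHull j (.inl u) := by
  set P := settingDHVolSharp X hlog M archPk archSub Ψ act Mmod region n lat sig split qData tq t htq0 htq1 with hP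
  show factorMapDH X hlog j (.inl u) ⁻¹' hullSet (factorFieldDH X hlog j (.inl u)) (qCentreDH X hlog tq j (.inl u)) ⊆
    (HullFrame.ofComparison (factorFieldDH X hlog j (.inl u)) (factorMapDH X hlog j (.inl u))).hull (⋃₀ P.possibleImages j (.inl u))
  exact HullFrame.preimage_hullSet_subset_hull_ofComparison (factorFieldDH X hlog j (.inl u)) (factorMapDH X hlog j (.inl u)) _ _
    fun s => s.elim

/-- **q-REGION ⊆ Θ-HULL AT `(j, p)` FROM MOVERS ON ALL `j+1` SLOTS** (sharp real setting `settingDHVolSharp`). The slot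
values of the box point are `1` on the non-last slots and `t_{Θ,j,x}` on the last slot (`labelIdele`, `t_{Θ,0,x} := 1`); if there are
`g_{a,x} ∈ Real.ismDH logv x` (every slot `a`, every place `x | p`) such that at EVERY tuple `v⃗` the product over the slots of
`‖g_{a,v_a}(slot value)‖` is `≥ ‖t_{q,v_j}‖`, then the q-pilot region at `(j, p)` lies in `ⁿ˒°𝒰_{j,p}`.
[claim: Mochizuki2012, status: disputed] [cite: DupuyHilado2025, §3.9, §4.9] -/
theorem qRegion_subset_thetaHull_settingDHVolSharp_of_slotMovers (j : (thetaIndex X).Label) (pp : Nat.Primes)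
    (hmov : haveI : Fact (pp : ℕ).Prime := ⟨pp.2⟩
      ∃ g : (thetaIndex X).Caps j → ∀ x : (thetaIndex X).Fibre (.inr pp),
          (logShellsDH X logv).carrier x.1 ≃ₗ[ℚ] (logShellsDH X logv).carrier x.1,
        (∀ a x, g a x ∈ ismDH logv x.1) ∧
        ∀ e : (thetaIndex X).Caps j → (thetaIndex X).Fibre (.inr pp),
          ‖tq pp (e (Fin.last _))‖ ≤
            ∏ a, ‖(presAt X hlog pp).φ (e a) (g a (e a) (((presAt X hlog pp).φ (e a)).symm
              (Pi.mulSingle (M := fun _ : (thetaIndex X).Caps j => (presAt X hlog pp).k (e a)) (Fin.last _)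
                (labelIdele X t pp j (e a)) a)))‖) :
    (settingDHVolSharp X hlog M archPk archSub Ψ act Mmod region n lat sig split qData tq t htq0 htq1).qRegion j (.inr pp) ⊆
      (settingDHVolSharp X hlog M archPk archSub Ψ act Mmod region n lat sig split qData tq t htq0 htq1).thetaHull j (.inr pp) := by
  haveI : Fact (pp : ℕ).Prime := ⟨pp.2⟩
  set P := settingDHVolSharp X hlog M archPk archSub Ψ act Mmod region n lat sig split qData tq t htq0 htq1 with hP
  show factorMapDH X hlog j (.inr pp) ⁻¹' hullSet (factorFieldDH X hlog j (.inr pp)) (qCentreDH X hlog tq j (.inr pp)) ⊆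
    (HullFrame.ofComparison (factorFieldDH X hlog j (.inr pp)) (factorMapDH X hlog j (.inr pp))).hull (⋃₀ P.possibleImages j (.inr pp))
  refine HullFrame.preimage_hullSet_subset_hull_ofComparison (factorFieldDH X hlog j (.inr pp))
    (factorMapDH X hlog j (.inr pp)) _ _ ?_
  · set L := logShellsDH X logv with hL
    set Pr := presAt X hlog pp with hPr
    -- the movers, one per (slot, place)
    obtain ⟨G, hG, hGn⟩ := hmov
    obtain ⟨Φ, hΦ, hΦj⟩ := L.exists_mem_Ind2Family_apply_eq
      (show L.factorwise j (.inr pp) (fun a => L.summandwise (.inr pp) (G a)) ∈ L.Ind2 j (.inr pp) from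
        ⟨G, fun a x => hG a x, rfl⟩)
    have hΦind : Φ ∈ Setting.indGroup (situationDHVol X hlog M archPk archSub Ψ act Mmod region) :=
      Subgroup.subset_closure (Or.inr hΦ)
    -- the point `x₀ = 1 ⊗ ⋯ ⊗ 1 ⊗ t_{Θ,j,v_j}` of the Θ-box at every summand
    let y : (thetaIndex X).Caps j → L.Packet1 (.inr pp) := fun a x =>
      (Pr.φ x).symm (Pi.mulSingle (M := fun _ : (thetaIndex X).Caps j => Pr.k x) (Fin.last _) (labelIdele X t pp j x) a)
    let x₀ : L.Packet j (.inr pp) := PiTensorProduct.tprod ℚ y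
    have hcmp : ∀ e : (thetaIndex X).Caps j → (thetaIndex X).Fibre (.inr pp),
        Pr.comparison j x₀ e = iota pp.1 (Pr.kk e) (Fin.last _) (labelIdele X t pp j (e (Fin.last _))) := by
      intro e
      rw [Pr.comparison_tprod, iota_eq_purePacket]
      refine congrArg (PiTensorProduct.tprod ℚ_[pp]) (funext fun a => ?_)
      rcases eq_or_ne a (Fin.last _) with rfl | ha
      · simp [y]
      · simp [y, Pi.mulSingle_eq_of_ne ha]
    have hx₀ : x₀ ∈ P.thetaRegion3 j (.inr pp) := by
      rw [hP, settingDHVolSharp, thetaRegion3_thetaBoxDH]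
      show (fun z => Pr.factorMap j z) x₀ ∈ Pr.boxOf (sharpBoxDH X hlog t pp j)
      intro e
      refine ⟨Pr.comparison j x₀ e, ?_, fun i => rfl⟩
      rw [hcmp e]
      exact ⟨1, Subring.one_mem _, mul_one _⟩
    -- the moved point: a pure tensor with slot components `g_{a,v_a}(slot value)`
    have hu : Φ j (.inr pp) x₀ ∈ ⋃₀ P.possibleImages j (.inr pp) :=
      Set.mem_sUnion.2 ⟨_, ⟨Φ, hΦind, rfl⟩, Set.mem_image_of_mem _ hx₀⟩
    have hcmp' : ∀ e : (thetaIndex X).Caps j → (thetaIndex X).Fibre (.inr pp),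
        Pr.comparison j (Φ j (.inr pp) x₀) e =
          purePacket pp.1 (Pr.kk e) fun a => Pr.φ (e a) (G a (e a) (y a (e a))) := by
      intro e
      let y' : (thetaIndex X).Caps j → L.Packet1 (.inr pp) := fun a x => G a x (y a x)
      have hΦx : Φ j (.inr pp) x₀ = PiTensorProduct.tprod ℚ y' := by
        rw [hΦj]
        exact PiTensorProduct.congr_tprod (fun a => L.summandwise (.inr pp) (G a)) y
      rw [hΦx, Pr.comparison_tprod]
      rfl
    rintro ⟨e, i⟩
    refine ⟨Φ j (.inr pp) x₀, hu, ?_⟩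
    show ‖dEquiv pp.1 (Pr.kk e) (iota pp.1 (Pr.kk e) (Fin.last _) (tq pp (e (Fin.last _)))) i‖ ≤
      ‖dEquiv pp.1 (Pr.kk e) (Pr.comparison j (Φ j (.inr pp) x₀) e) i‖
    rw [hcmp' e, norm_dEquiv_iota, NonIsometryMover.norm_dEquiv_purePacket]
    exact hGn e


/-! ## 2. Two targets: one family on the non-last slots (at the slot value `1`), one on the last slot (at `t_Θ`) -/

/-- **q-region ⊆ Θ-hull at `(j, p)` from TWO TARGET FUNCTIONS.** If at every place `x | p` some `g₁ ∈ Ism_x` moves `1` to norm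
`≥ R_x ≥ 0` and some `g₂ ∈ Ism_x` moves `t_{Θ,j,x}` to norm `≥ N_x ≥ 0`, and at EVERY tuple `v⃗ = (v_0, …, v_j)` the q-radius satisfies
`‖t_{q,v_j}‖ ≤ (Π_{a<j} R_{v_a}) · N_{v_j}`, then `q-region ⊆ ⁿ˒°𝒰_{j,p}`: the non-last slots DONATE the factors `R_{v_a}`.
[claim: Mochizuki2012, status: disputed] [cite: DupuyHilado2025, §3.9, §4.9] -/
theorem qRegion_subset_thetaHull_settingDHVolSharp_of_targets (j : (thetaIndex X).Label) (pp : Nat.Primes)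
    (R Nn : (thetaIndex X).Fibre (.inr pp) → ℝ) (hR0 : ∀ x, 0 ≤ R x) (hN0 : ∀ x, 0 ≤ Nn x)
    (hR : haveI : Fact (pp : ℕ).Prime := ⟨pp.2⟩
      ∀ x : (thetaIndex X).Fibre (.inr pp), ∃ g ∈ ismDH logv x.1,
        R x ≤ ‖(presAt X hlog pp).φ x (g (((presAt X hlog pp).φ x).symm 1))‖)
    (hN : haveI : Fact (pp : ℕ).Prime := ⟨pp.2⟩
      ∀ x : (thetaIndex X).Fibre (.inr pp), ∃ g ∈ ismDH logv x.1,
        Nn x ≤ ‖(presAt X hlog pp).φ x (g (((presAt X hlog pp).φ x).symm (labelIdele X t pp j x)))‖)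
    (hle : haveI : Fact (pp : ℕ).Prime := ⟨pp.2⟩
      ∀ e : (thetaIndex X).Caps j → (thetaIndex X).Fibre (.inr pp),
        ‖tq pp (e (Fin.last _))‖ ≤ (∏ a : Fin (j : ℕ), R (e a.castSucc)) * Nn (e (Fin.last _))) :
    (settingDHVolSharp X hlog M archPk archSub Ψ act Mmod region n lat sig split qData tq t htq0 htq1).qRegion j (.inr pp) ⊆
      (settingDHVolSharp X hlog M archPk archSub Ψ act Mmod region n lat sig split qData tq t htq0 htq1).thetaHull j (.inr pp) := by
  haveI : Fact (pp : ℕ).Prime := ⟨pp.2⟩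
  choose g₁ hg₁ hg₁n using hR
  choose g₂ hg₂ hg₂n using hN
  refine qRegion_subset_thetaHull_settingDHVolSharp_of_slotMovers X hlog M archPk archSub Ψ act Mmod region n lat sig split qData
    tq t htq0 htq1 j pp ⟨fun a x => if a = Fin.last _ then g₂ x else g₁ x, fun a x => ?_, fun e => ?_⟩
  · by_cases ha : a = Fin.last _
    · simp only [ha, if_true]; exact hg₂ x
    · simp only [if_neg ha]; exact hg₁ x
  · refine (hle e).trans ?_
    rw [Fin.prod_univ_castSucc]
    refine mul_le_mul (Finset.prod_le_prod (fun a _ => hR0 _) fun a _ => ?_) ?_ (hN0 _)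
      (Finset.prod_nonneg fun a _ => norm_nonneg _)
    · have hne : (a.castSucc : (thetaIndex X).Caps j) ≠ Fin.last _ := Fin.castSucc_ne_last a
      dsimp only
      rw [if_neg hne, Pi.mulSingle_eq_of_ne hne]
      exact hg₁n (e a.castSucc)
    · dsimp only
      rw [if_pos rfl, Pi.mulSingle_eq_same]
      exact hg₂n (e (Fin.last _))

/-! ## 3. One-factor supply at TAME places: the non-last slots donate `‖ϖ_v‖^{1−e_v}`, the last slot reaches its `p`-level top -/

/-- **At a tame place the value `1` is moved to norm `‖p‖⁻¹·‖ϖ_v‖ = ‖ϖ_v‖^{1−e_v} ≥ 1`** (`p > 2`, `e_v ≤ p − 2`, analytic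
logarithm: `log_p(𝒪_v^×) = 𝔪_v`, so `1` lies on the `p`-level `−1` of `𝔪_v`, on which DH's (Ind2) is transitive — abc-iut-w5-d236
`exists_mem_ismDH_norm_apply_eq_of_tame`). This is the CONTENT DONATED by a non-last capsule slot.
[cite: WeilBNT1967, Ch. II §2, Th. 1] [cite: DupuyHilado2025, §4.9] [cite: NeukirchANT1999, Ch. II Prop. (5.5)] -/
theorem exists_mem_ismDH_norm_one_eq_of_tame {p : ℕ} [hp : Fact p.Prime] (hlogp : LogvAnalyticAt p logv)
    (v : HeightOneSpectrum (𝓞 F)) (hv : ((p : ℕ) : 𝓞 F) ∈ v.asIdeal) (hp2 : 2 < p) (he : v.asIdeal.ramificationIdx ℤ ≤ p - 2)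
    {ϖ : (RescaledCompletion F p v hv)ˣ} (hϖ : IsUniformizer ϖ) :
    ∃ g ∈ ismDH logv (.inr v),
      ‖toR p v hv (g (ofR p v hv 1))‖ = ‖(p : ℚ_[p])‖⁻¹ * ‖(ϖ : RescaledCompletion F p v hv)‖ := by
  set K := RescaledCompletion F p v hv
  have hp0 : 0 < ‖(p : ℚ_[p])‖ := norm_pos_iff.2 (Nat.cast_ne_zero.mpr hp.out.ne_zero)
  -- `‖p‖ = ‖ϖ‖^e ≤ ‖ϖ‖`
  have hpϖ : ‖(p : ℚ_[p])‖ ≤ ‖(ϖ : K)‖ := by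
    rw [Padic.norm_p, ← norm_pow_absRamificationIdx p K hϖ]
    calc ‖(ϖ : K)‖ ^ absRamificationIdx p K ≤ ‖(ϖ : K)‖ ^ 1 :=
          pow_le_pow_of_le_one (norm_nonneg _) hϖ.norm_lt_one.le (absRamificationIdx_pos p K)
      _ = ‖(ϖ : K)‖ := pow_one _
  have h1 : ‖(p : ℚ_[p])‖ * (‖(p : ℚ_[p])‖ ^ (-1 : ℤ) * ‖(ϖ : K)‖) < ‖(1 : K)‖ := by
    rw [zpow_neg_one, ← mul_assoc, mul_inv_cancel₀ hp0.ne', one_mul, norm_one]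
    exact hϖ.norm_lt_one
  have h2 : ‖(1 : K)‖ ≤ ‖(p : ℚ_[p])‖ ^ (-1 : ℤ) * ‖(ϖ : K)‖ := by
    rw [norm_one, zpow_neg_one]
    calc (1 : ℝ) = ‖(p : ℚ_[p])‖⁻¹ * ‖(p : ℚ_[p])‖ := (inv_mul_cancel₀ hp0.ne').symm
      _ ≤ ‖(p : ℚ_[p])‖⁻¹ * ‖(ϖ : K)‖ := mul_le_mul_of_nonneg_left hpϖ (inv_nonneg.2 hp0.le)
  obtain ⟨g, hg, hgn⟩ := exists_mem_ismDH_norm_apply_eq_of_tame hlogp v hv hp2 he hϖ (-1) h1 h2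
  exact ⟨g, hg, by rw [hgn, zpow_neg_one]⟩

/-- The same read at a fibre point `x | p` of the pilot index through the presentation's `φ_x = id`: some `g ∈ Real.ismDH logv x`
has `‖p‖⁻¹·‖ϖ_x‖ ≤ ‖g 1‖`. [cite: WeilBNT1967, Ch. II §2, Th. 1] [cite: DupuyHilado2025, §4.9] -/
theorem exists_mem_ismDH_norm_one_ge_of_tame (pp : Nat.Primes) (x : (thetaIndex X).Fibre (.inr pp)) (hp2 : 2 < (pp : ℕ))
    {ρ : ℝ}
    (h : haveI : Fact (pp : ℕ).Prime := ⟨pp.2⟩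
      (placeOf X pp.1 x).asIdeal.ramificationIdx ℤ ≤ (pp : ℕ) - 2 ∧
        ∃ ϖ : (kOf X pp.1 x)ˣ, IsUniformizer ϖ ∧ ρ ≤ ‖(pp : ℚ_[pp])‖⁻¹ * ‖(ϖ : kOf X pp.1 x)‖) :
    haveI : Fact (pp : ℕ).Prime := ⟨pp.2⟩
    ∃ g ∈ ismDH logv x.1, ρ ≤ ‖(presAt X hlog pp).φ x (g (((presAt X hlog pp).φ x).symm 1))‖ := by
  haveI : Fact (pp : ℕ).Prime := ⟨pp.2⟩
  obtain ⟨he, ϖ, hϖ, hρ⟩ := h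
  obtain ⟨x1, hx⟩ := x
  rcases x1 with w | v
  · exact absurd hx (by simp [thetaIndex])
  · obtain ⟨g, hg, hgn⟩ := exists_mem_ismDH_norm_one_eq_of_tame (hlog pp) v (natCast_mem_placeOf X pp.1 ⟨.inr v, hx⟩) hp2 he hϖ
    exact ⟨g, hg, hρ.trans (le_of_eq hgn.symm)⟩

/-- **At a tame place the last-slot value `t_{Θ,j,x}` on the `p`-level `k` is moved to norm `‖p‖^k·‖ϖ_x‖`** (the top of its
level; abc-iut-w5-d236 `exists_mem_ismDH_norm_apply_eq_of_tame`, read through the presentation's `φ_x = id`).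
[cite: WeilBNT1967, Ch. II §2, Th. 1] [cite: DupuyHilado2025, §4.9] -/
theorem exists_mem_ismDH_norm_labelIdele_ge_of_tame (pp : Nat.Primes) (j : (thetaIndex X).Label)
    (x : (thetaIndex X).Fibre (.inr pp)) (hp2 : 2 < (pp : ℕ)) (k : ℤ) {Nw : ℝ}
    (h : haveI : Fact (pp : ℕ).Prime := ⟨pp.2⟩
      (placeOf X pp.1 x).asIdeal.ramificationIdx ℤ ≤ (pp : ℕ) - 2 ∧
        ∃ ϖ : (kOf X pp.1 x)ˣ, IsUniformizer ϖ ∧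
          ‖(pp : ℚ_[pp])‖ * (‖(pp : ℚ_[pp])‖ ^ k * ‖(ϖ : kOf X pp.1 x)‖) < ‖labelIdele X t pp j x‖ ∧
          ‖labelIdele X t pp j x‖ ≤ ‖(pp : ℚ_[pp])‖ ^ k * ‖(ϖ : kOf X pp.1 x)‖ ∧
          Nw = ‖(pp : ℚ_[pp])‖ ^ k * ‖(ϖ : kOf X pp.1 x)‖) :
    haveI : Fact (pp : ℕ).Prime := ⟨pp.2⟩
    ∃ g ∈ ismDH logv x.1, Nw ≤ ‖(presAt X hlog pp).φ x (g (((presAt X hlog pp).φ x).symm (labelIdele X t pp j x)))‖ := by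
  haveI : Fact (pp : ℕ).Prime := ⟨pp.2⟩
  obtain ⟨he, ϖ, hϖ, h1, h2, rfl⟩ := h
  obtain ⟨x1, hx⟩ := x
  rcases x1 with w | v
  · exact absurd hx (by simp [thetaIndex])
  · obtain ⟨g, hg, hgn⟩ := exists_mem_ismDH_norm_apply_eq_of_tame (hlog pp) v (natCast_mem_placeOf X pp.1 ⟨.inr v, hx⟩) hp2 he
      hϖ k h1 h2
    exact ⟨g, hg, le_of_eq hgn.symm⟩

/-! ## 4. The licence in the TAME MULTI-SLOT regime -/

/-- **q-REGION ⊆ Θ-HULL AT `(i+1, p)` IN THE TAME MULTI-SLOT REGIME.** Data at the prime `p`: a DONATION RATE `ρ ≥ 1` with, at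
EVERY place `x | p`, `p > 2`, `e_x ≤ p − 2` and `ρ ≤ ‖p‖⁻¹·‖ϖ_x‖` (`= ‖ϖ_x‖^{1−e_x}`; `ρ = 1` asks nothing beyond tameness); and at every
place `w | p` EITHER `‖t_{q,w}‖ ≤ ‖t_{Θ,i+1,w}‖` OR `t_{Θ,i+1,w}` lies on a `p`-level `k` of `𝔪_w` with `‖t_{q,w}‖ ≤ ρ^{i+1}·‖p‖^k·‖ϖ_w‖`
— the `i+1` non-last slots donate `ρ` each. Then the q-pilot region at `(i+1, p)` lies in `ⁿ˒°𝒰_{i+1,p}`.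
[cite: DupuyHilado2025, §3.9, §4.9] [cite: WeilBNT1967, Ch. II §2, Th. 1] [claim: Mochizuki2012, status: disputed] -/
theorem qRegion_subset_thetaHull_settingDHVolSharp_of_tame_slots (i : Fin (thetaIndex X).lstar) (pp : Nat.Primes) (ρ : ℝ)
    (hρ1 : 1 ≤ ρ)
    (hρ : haveI : Fact (pp : ℕ).Prime := ⟨pp.2⟩
      ∀ x : (thetaIndex X).Fibre (.inr pp),
        2 < (pp : ℕ) ∧ (placeOf X pp.1 x).asIdeal.ramificationIdx ℤ ≤ (pp : ℕ) - 2 ∧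
          ∃ ϖ : (kOf X pp.1 x)ˣ, IsUniformizer ϖ ∧ ρ ≤ ‖(pp : ℚ_[pp])‖⁻¹ * ‖(ϖ : kOf X pp.1 x)‖)
    (hwin : haveI : Fact (pp : ℕ).Prime := ⟨pp.2⟩
      ∀ w : (thetaIndex X).Fibre (.inr pp),
        ‖tq pp w‖ ≤ ‖t pp i w‖ ∨
          ∃ (ϖ : (kOf X pp.1 w)ˣ) (k : ℤ), IsUniformizer ϖ ∧
            ‖(pp : ℚ_[pp])‖ * (‖(pp : ℚ_[pp])‖ ^ k * ‖(ϖ : kOf X pp.1 w)‖) < ‖t pp i w‖ ∧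
            ‖t pp i w‖ ≤ ‖(pp : ℚ_[pp])‖ ^ k * ‖(ϖ : kOf X pp.1 w)‖ ∧
            ‖tq pp w‖ ≤ ρ ^ ((i : ℕ) + 1) * (‖(pp : ℚ_[pp])‖ ^ k * ‖(ϖ : kOf X pp.1 w)‖)) :
    (settingDHVolSharp X hlog M archPk archSub Ψ act Mmod region n lat sig split qData tq t htq0 htq1).qRegion
        (labelSucc i) (.inr pp) ⊆
      (settingDHVolSharp X hlog M archPk archSub Ψ act Mmod region n lat sig split qData tq t htq0 htq1).thetaHull
        (labelSucc i) (.inr pp) := by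
  haveI : Fact (pp : ℕ).Prime := ⟨pp.2⟩
  have hρ0 : 0 ≤ ρ := zero_le_one.trans hρ1
  -- per place: a last-slot target `N_w ≥ 0`, reached by a mover, with `‖t_{q,w}‖ ≤ ρ^{i+1}·N_w`
  have key : ∀ w : (thetaIndex X).Fibre (.inr pp), ∃ Nw : ℝ, 0 ≤ Nw ∧
      (∃ g ∈ ismDH logv w.1,
        Nw ≤ ‖(presAt X hlog pp).φ w (g (((presAt X hlog pp).φ w).symm (labelIdele X t pp (labelSucc i) w)))‖) ∧
      ‖tq pp w‖ ≤ ρ ^ ((i : ℕ) + 1) * Nw := by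
    intro w
    rcases hwin w with h | ⟨ϖ, k, hϖ, h1, h2, h3⟩
    · refine ⟨‖t pp i w‖, norm_nonneg _, ⟨LinearEquiv.refl ℚ _, refl_mem_ismDH logv w.1, ?_⟩, ?_⟩
      · rw [labelIdele_labelSucc]
        simp only [LinearEquiv.refl_apply, LinearEquiv.apply_symm_apply]
        exact le_of_eq rfl
      · exact h.trans (le_mul_of_one_le_left (norm_nonneg _) (one_le_pow₀ hρ1))
    · obtain ⟨hp2, he, -⟩ := hρ w
      refine ⟨‖(pp : ℚ_[pp])‖ ^ k * ‖(ϖ : kOf X pp.1 w)‖,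
        mul_nonneg (zpow_nonneg (norm_nonneg _) _) (norm_nonneg _), ?_, h3⟩
      exact exists_mem_ismDH_norm_labelIdele_ge_of_tame X hlog t pp (labelSucc i) w hp2 k
        ⟨he, ϖ, hϖ, by rw [labelIdele_labelSucc]; exact h1, by rw [labelIdele_labelSucc]; exact h2, rfl⟩
  choose Nf hN0 hN hle using key
  refine qRegion_subset_thetaHull_settingDHVolSharp_of_targets X hlog M archPk archSub Ψ act Mmod region n lat sig split qData
    tq t htq0 htq1 (labelSucc i) pp (fun _ => ρ) Nf (fun _ => hρ0) hN0 (fun x => ?_) hN fun e => ?_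
  · obtain ⟨hp2, he, ϖ, hϖ, hρle⟩ := hρ x
    exact exists_mem_ismDH_norm_one_ge_of_tame X hlog pp x hp2 ⟨he, ϖ, hϖ, hρle⟩
  · rw [Fin.prod_const]
    exact hle _

/-- At a prime with NO bad place over it both pilot ideles are units at every place over `p` (Θ-ideles units off `S`), and the
identity movers suffice. [folklore] -/
theorem qRegion_subset_thetaHull_settingDHVolSharp_of_forall_not_mem (i : Fin (thetaIndex X).lstar) (pp : Nat.Primes)
    (ht1 : ∀ (pp : Nat.Primes) (i : Fin X.lstar) (x : (thetaIndex X).Fibre (.inr pp)),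
      haveI : Fact (pp : ℕ).Prime := ⟨pp.2⟩; placeOf X pp.1 x ∉ X.S → ‖t pp i x‖ = 1)
    (hS : haveI : Fact (pp : ℕ).Prime := ⟨pp.2⟩; ∀ w : (thetaIndex X).Fibre (.inr pp), placeOf X pp.1 w ∉ X.S) :
    (settingDHVolSharp X hlog M archPk archSub Ψ act Mmod region n lat sig split qData tq t htq0 htq1).qRegion
        (labelSucc i) (.inr pp) ⊆
      (settingDHVolSharp X hlog M archPk archSub Ψ act Mmod region n lat sig split qData tq t htq0 htq1).thetaHull
        (labelSucc i) (.inr pp) := by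
  haveI : Fact (pp : ℕ).Prime := ⟨pp.2⟩
  refine qRegion_subset_thetaHull_settingDHVolSharp_of_targets X hlog M archPk archSub Ψ act Mmod region n lat sig split qData
    tq t htq0 htq1 (labelSucc i) pp (fun _ => 1) (fun w => ‖t pp i w‖) (fun _ => zero_le_one) (fun _ => norm_nonneg _)
    (fun x => ⟨LinearEquiv.refl ℚ _, refl_mem_ismDH logv x.1, ?_⟩)
    (fun w => ⟨LinearEquiv.refl ℚ _, refl_mem_ismDH logv w.1, ?_⟩) fun e => ?_
  · simp only [LinearEquiv.refl_apply, LinearEquiv.apply_symm_apply, norm_one]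
    exact le_rfl
  · rw [labelIdele_labelSucc]
    simp only [LinearEquiv.refl_apply, LinearEquiv.apply_symm_apply]
    exact le_of_eq rfl
  · rw [Finset.prod_const_one, one_mul, htq1 pp _ (hS _), ht1 pp i _ (hS _)]

end Summit.ABC.IUTFork.Thm311.Real

end
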